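import Summits.BirchSwinnertonDyer.BirchSwinnertonDyer.Theorems.RamifiedHeegnerPairGss2LowerAtThreeRankOneIrreducibleRoad
import Summits.BirchSwinnertonDyer.BirchSwinnertonDyer.Theorems.RamifiedHeegnerPairRamifiedPairUpperBoundShaDescentOdd
import Summits.BirchSwinnertonDyer.Rank1Residual.X1.RankZeroGrossZagierTwist
import Summits.BirchSwinnertonDyer.Rank1Residual.AdditivePotMult.QuadraticTorsionValuation
import Literature.NumberTheory.EllipticCurves.Rank1Residual.Typed.JointLower
import HarnessLib

/-!
# Route `RamifiedHeegnerPair`, residual member L₀ `Gss2LowerAtThreeRankZero` (stmt-BirchSwinnertonDyer-26023) and crux L₁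
# `Gss2LowerAtThreeRankOne` (26021) — the JOINT-LOWER calculus in McCallum currency, PART 1: the rank-ZERO orientation.
# ONE McCallum certificate at ONE split Heegner frame whose twist has analytic rank one pays EXACTLY the joint lower half
# `Typed.JointLowerBoundAt W Wd 3`; with U₁ of the twist it pays L₀(W) — a Heegner-pair DOOR to the residual member L₀

HONEST FRAMING. Theorems only (no definition, no named fact, no `sorry`); ROUTE-INDEPENDENT helper file (no Theses import;
`--supports stmt-BirchSwinnertonDyer-26023`); nothing is booked, no item is closed, BSD is not proved for any curve; every displayed
input is a hypothesis. Lead prover bsd-line-rhp-p1 g6, 2026-08-28. Mirror, on the LOWER side, of rhp-p2's rank-zero socket bookkeeping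
`RamifiedPairUpperBound.jointUpperBoundAt_three_of_indexUpper_rankZero` (p616826), with the upper socket replaced by the ADJUSTED STEP L of
p624620 §6 (`RamifiedPairLowerBound.adjustedIndexBound_of_certificate_of_structIrr`: ONE certificate + Kolyvagin's structure theorem
under irreducibility = the tree's Matar–Nekovář fact). PART 2 (the rank-ONE orientation, p624620 §8 re-derived through the joint
currency) is the sibling `…Gss2LowerAtThreeRankOneJointLowerCertificate.lean`.

WHY THIS FILE. Every theorem over an imaginary quadratic `K′` — Gross–Zagier, Kolyvagin, the structure theorem — pays for the PAIR
`(W, W^{(d_{K′})})` at once (`L(E/K′,s) = L(W,s)·L(Wd,s)`; `Ш(E/K′)[3^∞] = Ш(W)[3^∞] ⊕ Ш(Wd)[3^∞]`). The L₁ road of this route (p624620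
§8) subtracts the twist's UPPER half from that pair statement; the route's residual member L₀ (26023: «Kato-⊇ made index-exact at an
additive 3, announced on the Fouquet–Wan locus only; no seat attacks it») had NO Heegner-pair road. Here:

* §0 bookkeeping in analytic rank `0` (`#Ш_an = (L(E,1)/Ω)·t²/∏c`, its `3`-adic valuation).
* §1 `jointLowerBoundAt_three_of_structIrrCertificate_rankZero` — orientation (0, 1), NEW: `W` (parametrised, `r_an = 0`, `L(W,1)/Ω_W ∈ ℚ`
  given), twist `Wd` of analytic rank ONE with `#Ш_an(Wd) ∈ ℚ` given, Heegner point in the minus part: STRUCT ∧ ONE certificate ⟹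
  `JointLowerBoundAt W Wd 3`, through the SWAPPED Gross–Zagier display `TwistIdentity.padicValRat_add_eq_of_grossZagier_swap` (CGLS22 (5.6),
  ranks exchanged, Manin constant KEPT), the torsion transport `ord₃ t_K = ord₃ t_W + ord₃ t_d` and the odd-`p` descent of `Ш` — all
  torsion and Manin terms CANCEL (no `3 ∤ c`, no torsion hypothesis).
* §2 `missingLowerBoundAt_three_rankZero_of_structIrrCertificate_of_upperTwist` — the L₀ DOOR: L₀(W) ⟸ six named facts ∧ STRUCT ∧ ONE
  certificate at ONE split frame whose twist has analytic rank one ∧ U₁(Wd) (`MissingUpperBoundAt Wd 3`, the route's member 26022 at the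
  twist) ∧ `L(W,1)/Ω_W ∈ ℚ`; and the symmetric descent L₁(Wd) ⟸ §1 ∧ U₀(W). CONDITIONAL on U₁ exactly as rhp-p2's U₁ road (p622097) is
  conditional on L₀: modulo the pair statements (T1⁻ certificates, T1⁺ divisibilities) U₁ and L₀ are ONE separation statement — the
  lead's memo COUPLING-CALCULUS (crux dir of 26021) has the accounting.

References: [cite: MatarNekovar2019, Thm. 0.7 (p. 456) and §0.11 (p. 457)] [cite: McCallumLMS1991, §5 Lemma 5.1 (p. 303), Cor. 5.6 (p. 310)]
[cite: CastellaGrossiLeeSkinner2022, proof of Thm. 5.3.1, display (5.6)] [cite: GrossZagier1986, Thm. I.(6.3), I.(6.5), V.§2]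
[cite: JetchevSkinnerWan2017, §7.4.1 (pp. 29–31)] [cite: Miller2011LMS, Def. 1.1] [cite: Darmon2004, Thm. 3.6] [cite: GrossLMS1991, §4 (4.1)].
-/

-- D-0017: single-problem summit, so `Summit.BirchSwinnertonDyer.BirchSwinnertonDyer.…` repeats a namespace BY DESIGN.
set_option linter.dupNamespace false
set_option autoImplicit false

noncomputable section

open scoped Classical NumberField

open WeierstrassCurve NumberField IsDedekindDomain
  Literature.NumberTheory.EllipticCurves Literature.NumberTheory.EllipticCurves.ModularForms
  Literature.NumberTheory.EllipticCurves.Rank1Residual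
  Literature.NumberTheory.EllipticCurves.Rank1Residual.Typed
  Literature.NumberTheory.EllipticCurves.KrizLi2019
  Literature.NumberTheory.QuadraticFields
  Summit.BirchSwinnertonDyer.Rank1Residual
  Summit.BirchSwinnertonDyer.Rank1Residual.Additive
  Summit.BirchSwinnertonDyer.Rank1Residual.X11b
  Summit.BirchSwinnertonDyer.Rank1Residual.GaloisImage
  Summit.BirchSwinnertonDyer.BirchSwinnertonDyer.Theorems
  Summit.BirchSwinnertonDyer.BirchSwinnertonDyer.Theorems.AdditiveBranchIMCGordTwoRankOne

namespace Summit.BirchSwinnertonDyer.BirchSwinnertonDyer.Theorems.RamifiedPairLowerBound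

/-! ## §0 Bookkeeping in analytic rank zero -/

/-- In analytic rank `0` (`Reg = 1` by GZK), a rational value `q₀` of `L(E,1)/Ω_E` gives `#Ш(E)_an = q₀·#E(ℚ)_tors²/∏c_ℓ`, with
`q₀ ≠ 0` when `L(E,1) ≠ 0`. Bookkeeping. [cite: Miller2011LMS, Def. 1.1] -/
theorem shaAn_eq_of_lOne_div_eq_of_rankZero (hGZK : rank_eq_analyticRank_of_analyticRank_le_one)
    (V : WeierstrassCurve ℚ) [V.IsElliptic] (hr : V.analyticRank = 0) {q0 : ℚ}
    (hq0 : V.entireLFunction 1 / (V.realPeriodRat : ℂ) = (q0 : ℂ)) :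
    shaAn V = ((q0 * (V.torsionOrder : ℚ) ^ 2 / (V.tamagawaProduct : ℚ) : ℚ) : ℂ) := by
  have hrank : V.mordellWeilRank = 0 := by rw [(hGZK V (by rw [hr]; exact zero_le_one)).1, hr]
  have hΩ : (V.realPeriodRat : ℂ) ≠ 0 := by exact_mod_cast V.realPeriodRat_pos_holds.ne'
  have hc : (V.tamagawaProduct : ℂ) ≠ 0 := by exact_mod_cast V.tamagawaProduct_pos_holds.ne'
  have hL1 : V.entireLFunction 1 = (q0 : ℂ) * (V.realPeriodRat : ℂ) := by
    rw [← hq0, div_mul_cancel₀ _ hΩ]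
  rw [shaAn_def, V.leadingLCoeff_eq_of_analyticRank_eq_zero hr, hL1, V.regulator_eq_one_of_rank_zero hrank]
  push_cast
  field_simp

/-- The `3`-adic valuation of `q₀·t²/∏c`. Bookkeeping. [folklore] -/
theorem padicValRat_mul_sq_div (p : ℕ) [Fact p.Prime] {q0 : ℚ} (hq0 : q0 ≠ 0) {t c : ℕ} (ht : 0 < t) (hc : 0 < c) :
    padicValRat p (q0 * (t : ℚ) ^ 2 / (c : ℚ)) = padicValRat p q0 + 2 * padicValNat p t - padicValNat p c := by
  have htQ : (t : ℚ) ≠ 0 := by exact_mod_cast ht.ne'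
  have hcQ : (c : ℚ) ≠ 0 := by exact_mod_cast hc.ne'
  rw [padicValRat.div (mul_ne_zero hq0 (pow_ne_zero _ htQ)) hcQ, padicValRat.mul hq0 (pow_ne_zero _ htQ),
    padicValRat.pow, padicValRat.of_nat, padicValRat.of_nat]
  push_cast
  ring

/-! ## §1 Orientation (0, 1): the JOINT lower half from ONE certificate, `W` of analytic rank zero, the twist of analytic rank one -/

/-- **JOINT lower half of the pair `(W, W^{(d_K)})` from ONE certificate — orientation (0, 1), NEW.** `W/ℚ` globally minimal, non-CM,
additive at `3` (`3 ∣ N_W`), `W[3]` irreducible, `r_an(W) = 0` with `L(W,1)/Ω_W = q₀ ∈ ℚ` given; `K` imaginary quadratic Heegner for `N_W`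
(then `3` splits: `3 ∤ d_K`, `d_K ∉ {−3,−4}`, `3 ∤ #𝓞_K^×`); `(Dt, H, ι)` a parametrisation + Heegner datum at level `N_W` with Heegner point
`P ∈ E(K)` (in the minus part); `Wd = Cd • W^{(d_K)}` globally minimal of analytic rank ONE with `#Ш_an(Wd) = qd ∈ ℚ` given; ONE McCallum
certificate `Three.Koly.CertificateAt Dt H.β ι 3 M` of adjusted depth `2M ≤ ord₃∏c(W) + ord₃∏c(Wd) + 2·ord₃ c(Dt)`; Kolyvagin's structure
theorem as the Matar–Nekovář irreducible-image fact `hMN`. CONCLUSION: `Typed.JointLowerBoundAt W Wd 3`. Chain: `P` non-torsion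
(`L′(E/K,1) = L(W,1)·L′(Wd,1) ≠ 0`, Gross–Zagier), rank one + `Ш(E/K)` finite (Kolyvagin), `E(K)[3] = 0` (irreducibility), `3^{M₀} ∥ P`,
the conductor-`1` datum (Darmon 3.6 + Shimura reciprocity), the ADJUSTED STEP L of p624620 §6
(`2·ord₃[E(K):ℤP] ≤ ord₃#Ш(E/K) + ord₃∏c(W) + ord₃∏c(Wd) + 2·ord₃ c`), the SWAPPED Gross–Zagier display (CGLS22 (5.6), ranks exchanged,
Manin kept: `ord₃ q₀ + ord₃ q_d″ = 2·ord₃[E(K):ℤP] − 2·ord₃ c − 2·ord₃ #E(K)_tors` for `q_d″ = L′(Wd,1)/(Ω·Reg) = qd·∏c(Wd)/t_d²`), the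
torsion transport `ord₃ t_K = ord₃ t_W + ord₃ t_d` and the odd-`p` descent `ord₃#Ш(E/K) = ord₃#Ш(W) + ord₃#Ш(Wd)`; all torsion and Manin
terms CANCEL (no `3 ∤ c`, no `t = 1` needed). Mirror, on the lower side, of rhp-p2's `jointUpperBoundAt_three_of_indexUpper_rankZero`.
[cite: CastellaGrossiLeeSkinner2022, proof of Thm. 5.3.1, display (5.6)] [cite: MatarNekovar2019, Thm. 0.7 (p. 456) and §0.11 (p. 457)]
[cite: McCallumLMS1991, §5 Lemma 5.1 (p. 303) and Cor. 5.6 (p. 310)] [cite: GrossZagier1986, I.(6.5) and V.§2 (pp. 310–312)]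
[cite: JetchevSkinnerWan2017, §7.4.1 (arXiv:1512.06894 p. 30)] [cite: Darmon2004, Thm. 3.6] [cite: GrossLMS1991, §4 (4.1)]
[cite: Miller2011LMS, Def. 1.1] -/
theorem jointLowerBoundAt_three_of_structIrrCertificate_rankZero
    (W : WeierstrassCurve ℚ) [W.IsElliptic] [W.IsGloballyMinimal] [NeZero (W.conductorNorm ℤ)]
    (K : Type) [Field K] [NumberField K]
    (Dt : ModularParametrizationData W (W.conductorNorm ℤ))
    (H : HeegnerDatum (W.conductorNorm ℤ) (NumberField.discr K)) (ι : K →+* ℂ)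
    (P : (W.baseChange K).toAffine.Point)
    (hGZ : gross_zagier (W.conductorNorm ℤ) W K) (hKo : kolyvagin (W.conductorNorm ℤ) W K)
    (hGZK : rank_eq_analyticRank_of_analyticRank_le_one) (hmod : hasEntireLFunction_rat)
    (hrec : heegnerPointOfConductor_one_galoisConj (W.conductorNorm ℤ) W K)
    (h36 : phi_heegnerTau_mem_range_map_singularModuliField (W.conductorNorm ℤ) W K)
    (hMN : MatarNekovar2019.thm07_pow_dvd_card_sha_primary_of_certificate_of_irreducible)
    (hCM : ¬ W.HasCM) (h3N : 3 ∣ W.conductorNorm ℤ) (hirr : W.HasIrreducibleModPGaloisRep 3) (hr : W.analyticRank = 0)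
    (hK : IsImaginaryQuadratic K) (hHN : SatisfiesHeegnerHypothesis (W.conductorNorm ℤ) K)
    (hP : WeierstrassCurve.Affine.Point.map ι.toRatAlgHom P = heegnerPointComplex Dt H)
    {q0 : ℚ} (hq0 : W.entireLFunction 1 / (W.realPeriodRat : ℂ) = (q0 : ℂ))
    (Wd : WeierstrassCurve ℚ) [Wd.IsElliptic] [Wd.IsGloballyMinimal] (Cd : VariableChange ℚ)
    (hWd : Cd • W.quadraticTwist (NumberField.discr K : ℚ) = Wd) (hrd : Wd.analyticRank = 1)
    {qd : ℚ} (hqd : shaAn Wd = (qd : ℂ))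
    {M : ℕ} (hcert : Three.Koly.CertificateAt Dt H.β ι 3 M)
    (hM : (2 * M : ℤ) ≤ padicValNat 3 W.tamagawaProduct + padicValNat 3 Wd.tamagawaProduct +
      2 * padicValRat 3 (Dt.c : ℚ)) :
    JointLowerBoundAt W Wd 3 := by
  -- adapted from rhp-p2 `jointUpperBoundAt_three_of_indexUpper_rankZero` (p616826): the upper socket ↦ the adjusted STEP L of p624620 §6
  have hp2 : (3 : ℕ) ≠ 2 := by decide
  have hD0 : (NumberField.discr K : ℚ) ≠ 0 := by exact_mod_cast NumberField.discr_ne_zero K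
  haveI hEt : (W.quadraticTwist (NumberField.discr K : ℚ)).IsElliptic := W.isElliptic_quadraticTwist hD0
  -- `3` splits in `K`: `3 ∤ d_K`, `3 ∤ #𝓞_K^×`, `d_K ≠ -3`; and `d_K ≠ -4` since `β² ≡ d_K (mod 3)`
  obtain ⟨hd3, hμ⟩ := X11b.Three.not_dvd_discr_and_not_dvd_torsionOrder_of_heegner hK hHN hp2 h3N
  have h3 : NumberField.discr K ≠ -3 := fun h ↦ hd3 (h ▸ ⟨-1, by norm_num⟩)
  have h4 : NumberField.discr K ≠ -4 := by
    intro hK4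
    have h12 : (3 : ℤ) ∣ 4 * (W.conductorNorm ℤ : ℤ) := Dvd.dvd.mul_left (by exact_mod_cast h3N) 4
    have h3d : (3 : ℤ) ∣ H.β ^ 2 - NumberField.discr K := dvd_trans h12 H.dvd_sq_sub
    have hcast : ((H.β ^ 2 - NumberField.discr K : ℤ) : ZMod 3) = 0 :=
      (ZMod.intCast_zmod_eq_zero_iff_dvd _ 3).mpr h3d
    have hdK : ((NumberField.discr K : ℤ) : ZMod 3) = -4 := by rw [hK4]; push_cast; ring
    push_cast at hcast
    rw [hdK] at hcast
    have key : ∀ b : ZMod 3, b ^ 2 - (-4 : ZMod 3) ≠ 0 := by decide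
    exact key _ hcast
  haveI h3p : Fact (Nat.Prime 3) := ⟨Nat.prime_three⟩
  have hu : padicValRat 3 (Cd.u : ℚ) = 0 :=
    AdditivePotMult.padicValRat_u_eq_zero_of_twist_minimal_of_dvd W 3 K hK hHN h3N Cd hWd
  -- `L`-values: `L(W,1) ≠ 0`, `L(Wd,1) = 0`, `L′(Wd,1) ≠ 0`, so `L′(E/K,1) ≠ 0` and `P` is non-torsion; Kolyvagin
  have hLt' : (W.quadraticTwist (NumberField.discr K : ℚ)).entireLFunction = Wd.entireLFunction := by
    rw [← hWd, entireLFunction_smul]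
  have hrt : (W.quadraticTwist (NumberField.discr K : ℚ)).analyticRank = 1 := by
    rw [← hrd, ← hWd, analyticRank_smul]
  have hLt0 : (W.quadraticTwist (NumberField.discr K : ℚ)).entireLFunction 1 = 0 :=
    entireLFunction_one_eq_zero_of_analyticRank_eq_one hrt
  obtain ⟨hleadd, hderivd⟩ := leadingLCoeff_eq_deriv_of_analyticRank_eq_one hrd
  have hLW : W.entireLFunction 1 ≠ 0 := (W.analyticRank_eq_zero_iff_holds (hmod W)).1 hr
  have hLK : LDerivEK W K ≠ 0 := by
    rw [AdditivePotMult.lDerivEK_eq_mul_deriv W K hmod hLt0, hLt']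
    exact mul_ne_zero hLW hderivd
  have hPinf : ¬ IsOfFinAddOrder P :=
    (lDerivEK_ne_zero_iff_not_isOfFinAddOrder W (W.conductorNorm ℤ) K hGZ hK hHN ⟨Dt, H, ι, hP⟩).mp hLK
  obtain ⟨hrank, hSha⟩ := hKo hK hHN ⟨Dt, H, ι, hP⟩ hPinf
  haveI : Finite (W.baseChange K).sha := hSha
  -- the conductor-`1` Kolyvagin–Heegner datum with `P_1 = y_K = P`
  obtain ⟨d₁⟩ := nonempty_kolyvaginHeegnerData_one_of_darmon36 h36 hK Dt H.β ι H.dvd_sq_sub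
  have hPd : d₁.toGeomPoints d₁.derivedPoint = toGeomPoints (W.baseChange K) P :=
    KolyvaginBottom.toGeomPoints_derivedPoint_one_eq hrec hK hHN hP d₁ rfl
  -- `E(K)[3] = 0`
  have hbot := torsionBy_eq_bot_of_isImaginaryQuadratic_of_hasIrreducibleModPGaloisRep W K hK Nat.prime_three hirr
  have hiv : ∀ x : (W.baseChange K).toAffine.Point, (3 : ℕ) • x = 0 → x = 0 := fun x hx ↦ by
    have hmem : x ∈ AddSubgroup.torsionBy (W.baseChange K).toAffine.Point (((3 : ℕ) : ℕ) : ℤ) := by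
      rw [mem_torsionBy_iff, natCast_zsmul]
      exact hx
    rw [hbot] at hmem
    exact hmem
  -- `3^{M₀} ∥ P`
  haveI : Module.Finite ℤ (W.baseChange K).toAffine.Point := (W.baseChange K).module_finite_point_holds
  obtain ⟨M₀, x₀, hx₀, hmax⟩ := exists_pow_smul_eq_and_forall_ne hPinf (p := 3) Nat.prime_three.two_le
  have hdiv : ∃ Q : (W.baseChange K).toAffine.Point, ((3 ^ M₀ : ℕ) : ℤ) • Q = P :=
    ⟨x₀, by rw [natCast_zsmul]; exact hx₀⟩
  have hndiv : ¬ ∃ Q : (W.baseChange K).toAffine.Point, ((3 ^ (M₀ + 1) : ℕ) : ℤ) • Q = P := by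
    rintro ⟨Q, hQ⟩
    exact hmax Q (by rw [← natCast_zsmul]; exact hQ)
  -- the certificate ⟹ the ADJUSTED STEP L at the datum (p624620 §6; orientation-free)
  obtain ⟨n, r, d, hn, hnd⟩ := hcert
  have hL' : (2 * padicValNat 3 (AddSubgroup.zmultiples P).index : ℤ) ≤
      padicValNat 3 (W.baseChange K).shaOrder + padicValNat 3 W.tamagawaProduct +
        padicValNat 3 Wd.tamagawaProduct + 2 * padicValRat 3 (Dt.c : ℚ) :=
    adjustedIndexBound_of_certificate_of_structIrr hMN W hCM K hK h3 h4 hHN 3 hp2 hirr Dt H.β ι d₁ P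
      hPd hPinf hrank hiv hdiv hndiv d hn.1 hn.2.2 hnd Wd hM
  -- positivity / non-vanishing of the rationals
  have hΩW : (W.realPeriodRat : ℂ) ≠ 0 := by exact_mod_cast W.realPeriodRat_pos_holds.ne'
  have hΩd : (Wd.realPeriodRat : ℂ) ≠ 0 := by exact_mod_cast Wd.realPeriodRat_pos_holds.ne'
  have hRd : (Wd.regulator : ℂ) ≠ 0 := by exact_mod_cast Wd.regulator_pos'.ne'
  have hcd0 : (Wd.tamagawaProduct : ℂ) ≠ 0 := by exact_mod_cast Wd.tamagawaProduct_pos_holds.ne'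
  have htd0 : (Wd.torsionOrder : ℂ) ≠ 0 := by exact_mod_cast Wd.torsionOrder_pos_holds.ne'
  have hcdQ : (Wd.tamagawaProduct : ℚ) ≠ 0 := by exact_mod_cast Wd.tamagawaProduct_pos_holds.ne'
  have htdQ : (Wd.torsionOrder : ℚ) ≠ 0 := by exact_mod_cast Wd.torsionOrder_pos_holds.ne'
  have hq00 : q0 ≠ 0 := by
    intro h0
    apply hLW
    rw [← div_mul_cancel₀ (W.entireLFunction 1) hΩW, hq0, h0]
    simp
  -- `L′(Wd,1)/(Ω·Reg) = qd·∏c(Wd)/t_d²`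
  have hL : Wd.leadingLCoeff =
      (qd : ℂ) * ((Wd.realPeriodRat : ℂ) * (Wd.tamagawaProduct : ℂ) * (Wd.regulator : ℂ)) /
        (Wd.torsionOrder : ℂ) ^ 2 := by
    rw [shaAn_def] at hqd
    rw [← hqd]
    field_simp
  have hqd0 : qd ≠ 0 := by
    intro h0
    apply hderivd
    rw [← hleadd, hL, h0]
    simp
  have hqd' : Wd.leadingLCoeff / ((Wd.realPeriodRat * Wd.regulator : ℝ) : ℂ) =
      ((qd * (Wd.tamagawaProduct : ℚ) / (Wd.torsionOrder : ℚ) ^ 2 : ℚ) : ℂ) := by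
    rw [hL]
    push_cast
    field_simp
  -- the swapped Gross–Zagier display (Manin constant kept)
  have hid := TwistIdentity.padicValRat_add_eq_of_grossZagier_swap W 3 (W.conductorNorm ℤ) K Dt H ι P hGZ hKo hGZK
    hmod hK hHN hP (by norm_num) hμ hr Wd Cd hWd hu hrd q0 (qd * (Wd.tamagawaProduct : ℚ) / (Wd.torsionOrder : ℚ) ^ 2)
    hq0 hqd'
  -- torsion transport `ord₃ t_K = ord₃ t_W + ord₃ t_d`
  have htK : padicValNat 3 (W.baseChange K).torsionOrder = padicValNat 3 W.torsionOrder + padicValNat 3 Wd.torsionOrder := by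
    obtain ⟨θ, c, hθ, hcθ⟩ := Quadratic.exists_sq_eq_algebraMap (F := ℚ) (K := K) hK.1
    obtain ⟨qq, hqq, hdq⟩ := NumberField.exists_discr_eq_mul_sq hK.1 hθ hcθ
    exact AdditivePotMult.padicValNat_torsionOrder_baseChange_quadratic_anyRank W K hK.1 hθ hcθ hqq hdq Wd ⟨Cd, hWd⟩ 3 (by norm_num)
  -- the odd-`p` descent of `Ш`
  have hsha := RamifiedPairUpperBoundStubs.padicValNat_shaOrder_add_eq_of_shaFinite_baseChange W Wd
    (NumberField.discr K) K ⟨Cd, hWd⟩ hK (Or.inl rfl) hSha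
  have hshaK := Three.Koly.padicValNat_shaOrder_eq (W.baseChange K) 3
  -- `#Ш_an(W)` in rank zero
  have hshaW := shaAn_eq_of_lOne_div_eq_of_rankZero hGZK W hr hq0
  have v1 := padicValRat_mul_sq_div 3 hq00 W.torsionOrder_pos_holds W.tamagawaProduct_pos_holds
  have v2 : padicValRat 3 (qd * (Wd.tamagawaProduct : ℚ) / (Wd.torsionOrder : ℚ) ^ 2) =
      padicValRat 3 qd + padicValNat 3 Wd.tamagawaProduct - 2 * padicValNat 3 Wd.torsionOrder := by
    rw [padicValRat.div (mul_ne_zero hqd0 hcdQ) (pow_ne_zero _ htdQ), padicValRat.mul hqd0 hcdQ,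
      padicValRat.pow, padicValRat.of_nat, padicValRat.of_nat]
    ring
  have hcI : (padicValInt 3 Dt.c : ℤ) = padicValRat 3 (Dt.c : ℚ) := (padicValRat.of_int).symm
  refine ⟨q0 * (W.torsionOrder : ℚ) ^ 2 / (W.tamagawaProduct : ℚ), qd, hshaW, hqd, ?_⟩
  rw [v1]
  rw [v2, hcI] at hid
  have e2 : (padicValNat 3 (W.baseChange K).shaOrder : ℤ) = padicValNat 3 W.shaOrder + padicValNat 3 Wd.shaOrder := by
    rw [hshaK]; exact_mod_cast hsha.symm
  have e6 : (padicValNat 3 (W.baseChange K).torsionOrder : ℤ) = padicValNat 3 W.torsionOrder + padicValNat 3 Wd.torsionOrder := by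
    exact_mod_cast htK
  rw [e6] at hid
  linarith

/-! ## §2 The L₀ DOOR: the rank-zero LOWER half from ONE certificate at a frame whose twist has rank one, and U₁ of that twist -/

/-- **L₀(W) ⟸ §1 ∧ U₁(Wd) — NEW DOOR for the route's residual member `Gss2LowerAtThreeRankZero` (26023).** For `W` as in §1 (non-CM,
additive at `3`, `W[3]` irreducible — automatic on the Gss2 leaf —, `r_an(W) = 0`, `L(W,1)/Ω_W ∈ ℚ`), ONE split Heegner frame for `N_W` whose
twist `Wd` has analytic rank ONE, ONE McCallum certificate of adjusted depth, the Matar–Nekovář structure fact, and the UPPER half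
`MissingUpperBoundAt Wd 3` of the rank-one twist (the route's member U₁ 26022 at `Wd`; it also supplies `#Ш_an(Wd) ∈ ℚ`):
`Typed.MissingLowerBoundAt W 3`. Descent `Typed.missingLowerBoundAt_of_joint_of_upper`. Nothing here is Kato's main conjecture: this is the
Heegner-pair road to L₀, conditional on U₁ exactly as rhp-p2's U₁ road (p622097) is conditional on L₀.
[cite: MatarNekovar2019, Thm. 0.7 (p. 456) and §0.11 (p. 457)] [cite: CastellaGrossiLeeSkinner2022, proof of Thm. 5.3.1, display (5.6)]
[cite: McCallumLMS1991, §5 Lemma 5.1 (p. 303) and Cor. 5.6 (p. 310)] [cite: Miller2011LMS, Def. 1.1] -/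
theorem missingLowerBoundAt_three_rankZero_of_structIrrCertificate_of_upperTwist
    (W : WeierstrassCurve ℚ) [W.IsElliptic] [W.IsGloballyMinimal] [NeZero (W.conductorNorm ℤ)]
    (K : Type) [Field K] [NumberField K]
    (Dt : ModularParametrizationData W (W.conductorNorm ℤ))
    (H : HeegnerDatum (W.conductorNorm ℤ) (NumberField.discr K)) (ι : K →+* ℂ)
    (P : (W.baseChange K).toAffine.Point)
    (hGZ : gross_zagier (W.conductorNorm ℤ) W K) (hKo : kolyvagin (W.conductorNorm ℤ) W K)
    (hGZK : rank_eq_analyticRank_of_analyticRank_le_one) (hmod : hasEntireLFunction_rat)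
    (hrec : heegnerPointOfConductor_one_galoisConj (W.conductorNorm ℤ) W K)
    (h36 : phi_heegnerTau_mem_range_map_singularModuliField (W.conductorNorm ℤ) W K)
    (hMN : MatarNekovar2019.thm07_pow_dvd_card_sha_primary_of_certificate_of_irreducible)
    (hCM : ¬ W.HasCM) (h3N : 3 ∣ W.conductorNorm ℤ) (hirr : W.HasIrreducibleModPGaloisRep 3) (hr : W.analyticRank = 0)
    (hK : IsImaginaryQuadratic K) (hHN : SatisfiesHeegnerHypothesis (W.conductorNorm ℤ) K)
    (hP : WeierstrassCurve.Affine.Point.map ι.toRatAlgHom P = heegnerPointComplex Dt H)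
    (hratW : ∃ q0 : ℚ, W.entireLFunction 1 / (W.realPeriodRat : ℂ) = (q0 : ℂ))
    (Wd : WeierstrassCurve ℚ) [Wd.IsElliptic] [Wd.IsGloballyMinimal] (Cd : VariableChange ℚ)
    (hWd : Cd • W.quadraticTwist (NumberField.discr K : ℚ) = Wd) (hrd : Wd.analyticRank = 1)
    (hUd : MissingUpperBoundAt Wd 3)
    {M : ℕ} (hcert : Three.Koly.CertificateAt Dt H.β ι 3 M)
    (hM : (2 * M : ℤ) ≤ padicValNat 3 W.tamagawaProduct + padicValNat 3 Wd.tamagawaProduct +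
      2 * padicValRat 3 (Dt.c : ℚ)) :
    MissingLowerBoundAt W 3 := by
  obtain ⟨q0, hq0⟩ := hratW
  have hUd' := hUd
  obtain ⟨qd, hqd, -⟩ := hUd'
  exact missingLowerBoundAt_of_joint_of_upper
    (jointLowerBoundAt_three_of_structIrrCertificate_rankZero W K Dt H ι P hGZ hKo hGZK hmod hrec h36 hMN hCM h3N hirr hr hK hHN hP
      hq0 Wd Cd hWd hrd hqd hcert hM) hUd

/-- **Symmetric descent of §3: L₁ AT THE TWIST ⟸ §1 ∧ U₀(W).** At the rank-zero-parametrised frame, the rank-ONE twist's lower half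
`MissingLowerBoundAt Wd 3` follows from the joint lower half and the base curve's upper half `MissingUpperBoundAt W 3` (U₀ at `W`; it also
supplies `L(W,1)/Ω_W ∈ ℚ`), given `#Ш_an(Wd) ∈ ℚ`. [cite: Miller2011LMS, Def. 1.1] [cite: MatarNekovar2019, Thm. 0.7 (p. 456) and §0.11 (p. 457)] -/
theorem missingLowerBoundAt_twist_three_rankOne_of_structIrrCertificate_of_upperRankZero
    (W : WeierstrassCurve ℚ) [W.IsElliptic] [W.IsGloballyMinimal] [NeZero (W.conductorNorm ℤ)]
    (K : Type) [Field K] [NumberField K]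
    (Dt : ModularParametrizationData W (W.conductorNorm ℤ))
    (H : HeegnerDatum (W.conductorNorm ℤ) (NumberField.discr K)) (ι : K →+* ℂ)
    (P : (W.baseChange K).toAffine.Point)
    (hGZ : gross_zagier (W.conductorNorm ℤ) W K) (hKo : kolyvagin (W.conductorNorm ℤ) W K)
    (hGZK : rank_eq_analyticRank_of_analyticRank_le_one) (hmod : hasEntireLFunction_rat)
    (hrec : heegnerPointOfConductor_one_galoisConj (W.conductorNorm ℤ) W K)
    (h36 : phi_heegnerTau_mem_range_map_singularModuliField (W.conductorNorm ℤ) W K)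
    (hMN : MatarNekovar2019.thm07_pow_dvd_card_sha_primary_of_certificate_of_irreducible)
    (hCM : ¬ W.HasCM) (h3N : 3 ∣ W.conductorNorm ℤ) (hirr : W.HasIrreducibleModPGaloisRep 3) (hr : W.analyticRank = 0)
    (hK : IsImaginaryQuadratic K) (hHN : SatisfiesHeegnerHypothesis (W.conductorNorm ℤ) K)
    (hP : WeierstrassCurve.Affine.Point.map ι.toRatAlgHom P = heegnerPointComplex Dt H)
    (hUW : MissingUpperBoundAt W 3)
    (Wd : WeierstrassCurve ℚ) [Wd.IsElliptic] [Wd.IsGloballyMinimal] (Cd : VariableChange ℚ)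
    (hWd : Cd • W.quadraticTwist (NumberField.discr K : ℚ) = Wd) (hrd : Wd.analyticRank = 1)
    (hratd : ∃ qd : ℚ, shaAn Wd = (qd : ℂ))
    {M : ℕ} (hcert : Three.Koly.CertificateAt Dt H.β ι 3 M)
    (hM : (2 * M : ℤ) ≤ padicValNat 3 W.tamagawaProduct + padicValNat 3 Wd.tamagawaProduct +
      2 * padicValRat 3 (Dt.c : ℚ)) :
    MissingLowerBoundAt Wd 3 := by
  obtain ⟨qd, hqd⟩ := hratd
  obtain ⟨q0, hq0⟩ : ∃ q0 : ℚ, W.entireLFunction 1 / (W.realPeriodRat : ℂ) = (q0 : ℂ) := by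
    obtain ⟨q, hq, -⟩ := hUW
    have hrank : W.mordellWeilRank = 0 := by rw [(hGZK W (by rw [hr]; exact zero_le_one)).1, hr]
    have hΩ : (W.realPeriodRat : ℂ) ≠ 0 := by exact_mod_cast W.realPeriodRat_pos_holds.ne'
    have hc : (W.tamagawaProduct : ℂ) ≠ 0 := by exact_mod_cast W.tamagawaProduct_pos_holds.ne'
    have ht : (W.torsionOrder : ℂ) ≠ 0 := by exact_mod_cast W.torsionOrder_pos_holds.ne'
    refine ⟨q * (W.tamagawaProduct : ℚ) / (W.torsionOrder : ℚ) ^ 2, ?_⟩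
    rw [shaAn_def, W.leadingLCoeff_eq_of_analyticRank_eq_zero hr, W.regulator_eq_one_of_rank_zero hrank] at hq
    push_cast at hq ⊢
    rw [mul_one] at hq
    rw [div_eq_iff hΩ]
    rw [div_eq_iff (mul_ne_zero hΩ hc)] at hq
    field_simp
    linear_combination hq
  exact missingLowerBoundAt_partner_of_joint_of_upper
    (jointLowerBoundAt_three_of_structIrrCertificate_rankZero W K Dt H ι P hGZ hKo hGZK hmod hrec h36 hMN hCM h3N hirr hr hK hHN hP
      hq0 Wd Cd hWd hrd hqd hcert hM) hUW

end Summit.BirchSwinnertonDyer.BirchSwinnertonDyer.Theorems.RamifiedPairLowerBound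

end
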